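import Mathlib
import HarnessLib
import Summits.HubbardSuperconductivity.HubbardSuperconductivity.Theorems.KLProgrammeKLRegimeSplitFermiPointSmooth

/-!
# Route `KLProgramme` — the local part `θ ↦ klLocalPart L M β U μ K n θ` is `C^m` in the angle for EVERY `m`
# (the structural conjunct `ContDiff ℝ 4 (klLocalPart …)` of the engine's angular clause (E3g) `TwoLegAngularG`, discharged generically)

Cell gate-hubbard-kl, seat p1b (g4).  `klLocalPart L M β U μ K n θ = (symInterp L (klLocSelfEnergyRe …)).eval (klFermiPoint μ K θ)`
(`…SplitTwoLegF`) is the composition of a frame's evaluation map (smooth on `Fin 2 → ℝ`, `TrigPolyC4v.contDiff_eval`) with the frame's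
Fermi point (`contDiff_klFermiPoint`, `…SplitFermiPointSmooth`, from p4's implicit-function regularity).  Hence, under the admissibility
hypotheses of the frame (`|K| ≤ κ₀`, `‖D(−K)‖ ≤ κ₁ < Dt_min` on the closed square, `[μ − κ₀, μ + κ₀] ⊂ [a, b]`), the local part is `C^m` in
`θ` for every `m` and every volume, scale and data — so (E3g)'s first conjunct costs the engine nothing beyond the FrameOK bookkeeping;
only the derivative SIZES are analysis.  Proofs only; nothing is asserted about the model.
-/

noncomputable section

namespace Summit.HubbardSuperconductivity.HubbardSuperconductivity.Theorems.KLRegimeSplit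

set_option linter.dupNamespace false -- summit = problem name (single-conjunct summit), D-0017

open Real Set
open Literature.MathematicalPhysics.QuantumLattice Literature.MathematicalPhysics.QuantumLattice.BandSectorCounting
open Summit.HubbardSuperconductivity.HubbardSuperconductivity.Theorems.PerturbedFermiCurve

/-- **The local part is `C^m` in the angle** (any `m ≠ 0`, any volume `(L, M)`, inverse temperature, coupling, scale `n`): composition of the
smooth evaluation map of the interpolant with the `C^m` Fermi point of the frame. -/
theorem contDiff_klLocalPart (L M : ℕ) [NeZero L] [NeZero M] {a b : ℝ} (B : BandBounds a b) (K : TrigPolyC4v) {m : WithTop ℕ∞}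
    (hm : m ≠ 0) {κ₀ κ₁ μ : ℝ} (hK : ∀ k : Fin 2 → ℝ, (∀ i, |k i| ≤ π) → |K.eval k| ≤ κ₀) (hlo : a ≤ μ - κ₀) (hhi : μ + κ₀ ≤ b)
    (hκ : ∀ k : Fin 2 → ℝ, (∀ i, |k i| ≤ π) → ‖fderiv ℝ (fun p => -K.eval p) k‖ ≤ κ₁) (hκ₁ : κ₁ < B.Dtmin) (β U : ℝ) (n : ℕ) :
    ContDiff ℝ m (klLocalPart L M β U μ K n) := by
  have h : klLocalPart L M β U μ K n = (symInterp L (klLocSelfEnergyRe L M β U μ K n)).eval ∘ klFermiPoint μ K := rfl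
  rw [h]
  exact (TrigPolyC4v.contDiff_eval _).comp (contDiff_klFermiPoint B K hm hK hlo hhi hκ hκ₁)

/-- In particular the structural conjunct of (E3g): `ContDiff ℝ 4 (klLocalPart …)`. -/
theorem contDiff_four_klLocalPart (L M : ℕ) [NeZero L] [NeZero M] {a b : ℝ} (B : BandBounds a b) (K : TrigPolyC4v) {κ₀ κ₁ μ : ℝ}
    (hK : ∀ k : Fin 2 → ℝ, (∀ i, |k i| ≤ π) → |K.eval k| ≤ κ₀) (hlo : a ≤ μ - κ₀) (hhi : μ + κ₀ ≤ b)
    (hκ : ∀ k : Fin 2 → ℝ, (∀ i, |k i| ≤ π) → ‖fderiv ℝ (fun p => -K.eval p) k‖ ≤ κ₁) (hκ₁ : κ₁ < B.Dtmin) (β U : ℝ) (n : ℕ) :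
    ContDiff ℝ 4 (klLocalPart L M β U μ K n) :=
  contDiff_klLocalPart L M B K (by norm_num) hK hlo hhi hκ hκ₁ β U n

/-- The local part is differentiable in the angle. -/
theorem differentiable_klLocalPart (L M : ℕ) [NeZero L] [NeZero M] {a b : ℝ} (B : BandBounds a b) (K : TrigPolyC4v) {κ₀ κ₁ μ : ℝ}
    (hK : ∀ k : Fin 2 → ℝ, (∀ i, |k i| ≤ π) → |K.eval k| ≤ κ₀) (hlo : a ≤ μ - κ₀) (hhi : μ + κ₀ ≤ b)
    (hκ : ∀ k : Fin 2 → ℝ, (∀ i, |k i| ≤ π) → ‖fderiv ℝ (fun p => -K.eval p) k‖ ≤ κ₁) (hκ₁ : κ₁ < B.Dtmin) (β U : ℝ) (n : ℕ) :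
    Differentiable ℝ (klLocalPart L M β U μ K n) :=
  (contDiff_klLocalPart L M B K one_ne_zero hK hlo hhi hκ hκ₁ β U n).differentiable one_ne_zero

end Summit.HubbardSuperconductivity.HubbardSuperconductivity.Theorems.KLRegimeSplit

end
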